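import Literature.NumberTheory.EllipticCurves.WeierstrassTransformation
import HarnessLib

/-!
# The transformation of order `n` of `℘`, order five, and complex multiplication of norm five

Topic `Literature/NumberTheory/EllipticCurves`; dot-notation extensions of Mathlib's `PeriodPair`,
continuing `WeierstrassTransformation.lean` (orders two and three).  Everything here is **proved**;
it is level 4 of the decomposition of
`Literature.NumberTheory.EllipticCurves.finite_point_of_j_mem_maximalCMJInvariants_of_L_one_ne_zero` (Coates–Wiles 1977,
Thm. 1), serving the row `d = −19` (`j((1 + √−19)/2) = −884736 = −96³`) of the singular-moduli
leaf `Literature.NumberTheory.EllipticCurves.singularModuli_classNumberOne` (Cox, table (12.20);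
`ComplexMultiplicationSingularModuliRows.lean`).

Notation: `Λ ⊂ Λ'` lattices (period pairs `L, L'`), `℘ = ℘_Λ`, `G_k = G_k(Λ)` (Mathlib
`PeriodPair.G`), `g₂ = 60G₄`, `g₃ = 140G₆`.

* `PeriodPair.weierstrassP_transformation` : **the transformation of order `n`** — if `S ∋ 0` is
  a system of representatives of `Λ'/Λ` (`x ∈ Λ' ↔ ∃ c ∈ S, x − c ∈ Λ`, distinct classes), then
  for `z ∉ Λ'`, `℘_{Λ'}(z) = Σ_{c ∈ S} ℘(z − c) − Σ_{c ∈ S, c ≠ 0} ℘(c)` — Lawden, *Elliptic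
  Functions and Applications*, §9.8 ((9.8.3)–(9.8.7), (9.8.14): every transformation of order
  `n` is a product of first-order ones and of `℘(u | nω₁, ω₃) = n⁻²{Σ_k ℘(u/n + 2kω₁/n) − Σ_{k≠0}
  ℘(2kω₁/n)}`, "it follows, therefore, using Liouville's theorem"); proved by Liouville's theorem:
  the difference, extended over `Λ'` class by class (`PeriodPair.transAux`), is `Λ`-periodic and
  entire.
* `PeriodPair.weierstrassP_of_indexFive` : the cyclic case of order five,
  `Λ' = Λ ∪ (±w + Λ) ∪ (±2w + Λ)` (`w, 2w, 3w, 4w ∉ Λ`):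
  `℘_{Λ'} = ℘ + ℘(· − w) + ℘(· + w) + ℘(· − 2w) + ℘(· + 2w) − 2e₁ − 2e₂`, `e₁ = ℘(w)`,
  `e₂ = ℘(2w)`.
* `PeriodPair.G_four_of_indexFive`, `PeriodPair.G_six_of_indexFive` : **the invariants**,
  `G₄(Λ') = 2e₁² + 2e₂² − 19G₄`, `G₆(Λ') = 2e₁³ + 2e₂³ − 18(e₁ + e₂)G₄ − 55G₆` (Vélu's formulae in
  degree five), read off — as in orders two and three — from the Taylor coefficients at `0` of
  `S₅ = (℘⁻_{Λ'} − ℘⁻)(z²℘⁻ + 1 − e₁z²)²(z²℘⁻ + 1 − e₂z²)²`, which equals an explicit analytic germ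
  `R₅` off `0` by the order-five formula and `℘(z + w) + ℘(z − w)`
  (`PeriodPair.weierstrassP_add_add_weierstrassP_sub`) at `w` and `2w`.
* `PeriodPair.duplication_relation` :
  `4(℘(2u) + 2℘(u))(4℘(u)³ − g₂℘(u) − g₃) = (6℘(u)² − g₂/2)²` (`u, 2u ∉ Λ`), from the duplication
  formula (Lawden (6.8.10), `v → u`; tree `PeriodPair.weierstrassP_two_mul_holds`,
  `PeriodPair.deriv_derivWeierstrassP`).
* `PeriodPair.weierstrassP_sq_of_cmFive`, `PeriodPair.G_six_of_cmFive` : complex multiplication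
  by `α` of norm `5` (`Λ' = α⁻¹Λ`): `2e₁² + 2e₂² = (α⁴ + 19)G₄`,
  `(α⁶ + 55)G₆ = 2e₁³ + 2e₂³ − 18(e₁ + e₂)G₄`.
* `PeriodPair.j_eq_of_cmFive_of_sq_eq_self_sub_five` : **`α² = α − 5` ⇒ `j(Λ) = −884736`.**  The
  method of Stark (Cox §10.C, (10.21)–(10.22)) in norm `5`: besides the two CM relations one uses
  the duplication relations at `w` and `2w` (`℘(4w) = e₁` since `5w ∈ Λ`); their difference
  divided by `e₁ − e₂` is the symmetric cubic `s³ − 6ps + 30G₄s + 140G₆ = 0` (`s = e₁ + e₂`,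
  `p = e₁e₂`), and elimination gives `2s² = 15(5 − α)G₄`, `280G₆ = −3(9 + α)sG₄`,
  `6272G₆² = 2565G₄³`, `j = 1728g₂³/(g₂³ − 27g₃²) = −884736` (Cox's table (12.20) obtains this
  value by the `q`-expansion method of §12.C).

Design notes.  The representative system is a `Finset ℂ`; the value of the auxiliary function on
the class of `c₀ ∈ S` is `−Σ_{c ≠ c₀} ℘(c₀ − c)` (all these values turn out equal, which is not
used).  The fourth derivative of the five-fold product `S₅` is a large but mechanical Leibniz
expansion (`set_option maxHeartbeats 800000` for that lemma only).

## References

* D. F. Lawden, *Elliptic Functions and Applications*, Applied Math. Sciences 80, Springer 1989: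
  §6.8 eq. (6.8.10); §9.8 eqs. (9.8.3)–(9.8.7), (9.8.14) (PDF pp. 166, 246–247).
* D. A. Cox, *Primes of the form x² + ny²*, 2nd ed., Wiley 2013: §10.C eqs. (10.21)–(10.22)
  (PDF pp. 223–224); §12.C table (12.20) (PDF pp. 266–267).
-/

noncomputable section

open scoped Topology
open Filter Set Complex

namespace PeriodPair

variable {L L' : PeriodPair} {w : ℂ}

/-! ### The transformation of order `n`: `Λ' = ⋃_{c ∈ S} (c + Λ)` -/

section Transformation

variable {S : Finset ℂ}

/-- `Λ ≤ Λ'` when `S ∋ 0` is a system of representatives of `Λ'/Λ`. [folklore] -/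
lemma le_of_reps (hS : ∀ x, x ∈ L'.lattice ↔ ∃ c ∈ S, x - c ∈ L.lattice) (hS0 : (0 : ℂ) ∈ S) :
    L.lattice ≤ L'.lattice := fun x hx ↦ (hS x).mpr ⟨0, hS0, by simpa using hx⟩

/-- Representatives lie in `Λ'`. [folklore] -/
lemma mem_of_mem_reps (hS : ∀ x, x ∈ L'.lattice ↔ ∃ c ∈ S, x - c ∈ L.lattice) {c : ℂ}
    (hc : c ∈ S) : c ∈ L'.lattice := (hS c).mpr ⟨c, hc, by simp⟩

/-- Off `Λ'`, `z - c ∉ Λ` for every representative `c`. [folklore] -/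
lemma sub_notMem_of_notMem_of_reps (hS : ∀ x, x ∈ L'.lattice ↔ ∃ c ∈ S, x - c ∈ L.lattice)
    {z c : ℂ} (hz : z ∉ L'.lattice) (hc : c ∈ S) : z - c ∉ L.lattice :=
  fun h ↦ hz ((hS z).mpr ⟨c, hc, h⟩)

/-- Uniqueness of the representative of a class. [folklore] -/
lemma reps_unique (hSd : ∀ c ∈ S, ∀ c' ∈ S, c - c' ∈ L.lattice → c = c') {x c c' : ℂ}
    (hc : c ∈ S) (hc' : c' ∈ S) (hx : x - c ∈ L.lattice) (hx' : x - c' ∈ L.lattice) : c = c' := by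
  refine (hSd c' hc' c hc ?_).symm
  have : c' - c = (x - c) - (x - c') := by ring
  rw [this]
  exact sub_mem hx hx'

/-- The auxiliary function of the Liouville argument for the transformation of order `n`:
`℘_{Λ'}(z) - Σ_{c ∈ S} ℘_Λ(z - c)` off `Λ'`, extended on the class `c₀ + Λ` (`c₀ ∈ S`) by
`-Σ_{c ∈ S, c ≠ c₀} ℘_Λ(c₀ - c)`. [folklore] -/
def transAux (L L' : PeriodPair) (S : Finset ℂ)
    (hS : ∀ x, x ∈ L'.lattice ↔ ∃ c ∈ S, x - c ∈ L.lattice) (z : ℂ) : ℂ :=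
  letI := Classical.propDecidable
  if hz : z ∈ L'.lattice then
    -∑ c ∈ S.erase (Classical.choose ((hS z).mp hz)), ℘[L] (Classical.choose ((hS z).mp hz) - c)
  else ℘[L'] z - ∑ c ∈ S, ℘[L] (z - c)

/-- Value of the auxiliary function on the class `c₀ + Λ`, `c₀ ∈ S`. [folklore] -/
lemma transAux_of_sub_mem (hS : ∀ x, x ∈ L'.lattice ↔ ∃ c ∈ S, x - c ∈ L.lattice)
    (hSd : ∀ c ∈ S, ∀ c' ∈ S, c - c' ∈ L.lattice → c = c') {z c₀ : ℂ} (hc₀ : c₀ ∈ S)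
    (hz : z - c₀ ∈ L.lattice) :
    transAux L L' S hS z = -∑ c ∈ S.erase c₀, ℘[L] (c₀ - c) := by
  have hzΛ' : z ∈ L'.lattice := (hS z).mpr ⟨c₀, hc₀, hz⟩
  have hspec := Classical.choose_spec ((hS z).mp hzΛ')
  have hrep : Classical.choose ((hS z).mp hzΛ') = c₀ :=
    reps_unique hSd hspec.1 hc₀ hspec.2 hz
  classical
  simp only [transAux, dif_pos hzΛ']
  rw [hrep]

/-- Value of the auxiliary function off `Λ'`. [folklore] -/
lemma transAux_of_notMem (hS : ∀ x, x ∈ L'.lattice ↔ ∃ c ∈ S, x - c ∈ L.lattice) {z : ℂ}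
    (hz : z ∉ L'.lattice) : transAux L L' S hS z = ℘[L'] z - ∑ c ∈ S, ℘[L] (z - c) := by
  classical
  simp only [transAux, dif_neg hz]

/-- `Λ`-periodicity of the auxiliary function. [folklore] -/
lemma transAux_add_coe (hS : ∀ x, x ∈ L'.lattice ↔ ∃ c ∈ S, x - c ∈ L.lattice)
    (hS0 : (0 : ℂ) ∈ S) (hSd : ∀ c ∈ S, ∀ c' ∈ S, c - c' ∈ L.lattice → c = c')
    (z : ℂ) (l : L.lattice) : transAux L L' S hS (z + l) = transAux L L' S hS z := by
  have hl' : (l : ℂ) ∈ L'.lattice := le_of_reps hS hS0 l.2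
  by_cases hz : z ∈ L'.lattice
  · obtain ⟨c₀, hc₀, hzc⟩ := (hS z).mp hz
    have hzc' : z + l - c₀ ∈ L.lattice := by
      rw [show z + l - c₀ = (z - c₀) + l by ring]; exact add_mem hzc l.2
    rw [transAux_of_sub_mem hS hSd hc₀ hzc, transAux_of_sub_mem hS hSd hc₀ hzc']
  · have hz' : z + l ∉ L'.lattice := fun h ↦ hz (by simpa using sub_mem h hl')
    rw [transAux_of_notMem hS hz, transAux_of_notMem hS hz', ← Subtype.coe_mk (l : ℂ) hl',
      L'.weierstrassP_add_coe]
    congr 1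
    refine Finset.sum_congr rfl fun c _ ↦ ?_
    rw [Subtype.coe_mk, show z + l - c = (z - c) + l by ring, L.weierstrassP_add_coe]

/-- `Λ`-periodicity of the auxiliary function (subtractive form). [folklore] -/
lemma transAux_sub_coe (hS : ∀ x, x ∈ L'.lattice ↔ ∃ c ∈ S, x - c ∈ L.lattice)
    (hS0 : (0 : ℂ) ∈ S) (hSd : ∀ c ∈ S, ∀ c' ∈ S, c - c' ∈ L.lattice → c = c')
    (z : ℂ) (l : L.lattice) : transAux L L' S hS (z - l) = transAux L L' S hS z := by
  rw [← transAux_add_coe hS hS0 hSd (z - l) l, sub_add_cancel]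

/-- Analyticity of the auxiliary function at a representative `c₀ ∈ S`: near `c₀` it is
`℘⁻ᶜ⁰_{Λ'}(z) - c₀⁻² - ℘⁻_Λ(z - c₀) - Σ_{c ≠ c₀} ℘_Λ(z - c)`. [folklore] -/
lemma analyticAt_transAux_rep (hS : ∀ x, x ∈ L'.lattice ↔ ∃ c ∈ S, x - c ∈ L.lattice)
    (hSd : ∀ c ∈ S, ∀ c' ∈ S, c - c' ∈ L.lattice → c = c') {c₀ : ℂ} (hc₀ : c₀ ∈ S) :
    AnalyticAt ℂ (transAux L L' S hS) c₀ := by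
  classical
  have hc₀Λ' : c₀ ∈ L'.lattice := mem_of_mem_reps hS hc₀
  have hother : ∀ c ∈ S.erase c₀, c₀ - c ∉ L.lattice := fun c hc h ↦
    (Finset.mem_erase.mp hc).1 ((hSd c₀ hc₀ c (Finset.mem_erase.mp hc).2 h).symm)
  have hg : AnalyticAt ℂ (fun z ↦ ℘[L' - c₀] z - 1 / c₀ ^ 2 - ℘[L - (0 : ℂ)] (z - c₀) -
      ∑ c ∈ S.erase c₀, ℘[L] (z - c)) c₀ := by
    have h1 := L'.analyticAt_weierstrassPExcept c₀
    have h2 := L.analyticAt_weierstrassPExcept_sub_const c₀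
    have h3 : AnalyticAt ℂ (fun z ↦ ∑ c ∈ S.erase c₀, ℘[L] (z - c)) c₀ :=
      Finset.analyticAt_fun_sum _ fun c hc ↦ L.analyticAt_weierstrassP_sub_const c (hother c hc)
    exact ((h1.sub analyticAt_const).sub h2).sub h3
  refine hg.congr ?_
  filter_upwards [L'.compl_lattice_sdiff_singleton_mem_nhds c₀] with z hz
  have hdef : ∀ z, ℘[L' - c₀] z = ℘[L'] z + (1 / c₀ ^ 2 - 1 / (z - c₀) ^ 2) := fun z ↦
    L'.weierstrassPExcept_def ⟨c₀, hc₀Λ'⟩ z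
  by_cases hzc : z = c₀
  · rw [hzc, transAux_of_sub_mem hS hSd hc₀ (by simp), hdef, sub_self, L.weierstrassPExcept_zero,
      show ℘[L'] c₀ = 0 from L'.weierstrassP_coe ⟨c₀, hc₀Λ'⟩]
    simp
  · have hzΛ' : z ∉ L'.lattice := fun h ↦ hz ⟨h, hzc⟩
    rw [transAux_of_notMem hS hzΛ', hdef, ← Finset.add_sum_erase S (fun c ↦ ℘[L] (z - c)) hc₀,
      L.weierstrassP_eq_weierstrassPExcept_add (z - c₀)]
    ring

/-- The auxiliary function is entire. [folklore] -/
lemma analyticAt_transAux (hS : ∀ x, x ∈ L'.lattice ↔ ∃ c ∈ S, x - c ∈ L.lattice)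
    (hS0 : (0 : ℂ) ∈ S) (hSd : ∀ c ∈ S, ∀ c' ∈ S, c - c' ∈ L.lattice → c = c') (x : ℂ) :
    AnalyticAt ℂ (transAux L L' S hS) x := by
  by_cases hx : x ∈ L'.lattice
  · obtain ⟨c₀, hc₀, hxc⟩ := (hS x).mp hx
    lift x - c₀ to L.lattice using hxc with l hl
    have hy := analyticAt_transAux_rep hS hSd hc₀
    have ht : AnalyticAt ℂ (fun z : ℂ ↦ z - l) x := by fun_prop
    have := hy.comp_of_eq ht (by rw [hl]; ring)
    rw [Function.comp_def] at this
    simpa only [transAux_sub_coe hS hS0 hSd] using this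
  · have hg : AnalyticAt ℂ (fun z ↦ ℘[L'] z - ∑ c ∈ S, ℘[L] (z - c)) x :=
      (L'.analyticOnNhd_weierstrassP x hx).sub (Finset.analyticAt_fun_sum _ fun c hc ↦
        L.analyticAt_weierstrassP_sub_const c (sub_notMem_of_notMem_of_reps hS hx hc))
    refine hg.congr ?_
    filter_upwards [L'.isClosed_lattice.isOpen_compl.mem_nhds hx] with z hz
    rw [transAux_of_notMem hS hz]

/-- The auxiliary function is constant (Liouville). [folklore] -/
lemma transAux_eq (hS : ∀ x, x ∈ L'.lattice ↔ ∃ c ∈ S, x - c ∈ L.lattice)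
    (hS0 : (0 : ℂ) ∈ S) (hSd : ∀ c ∈ S, ∀ c' ∈ S, c - c' ∈ L.lattice → c = c') (z : ℂ) :
    transAux L L' S hS z = -∑ c ∈ S.erase 0, ℘[L] c := by
  have hd : Differentiable ℂ (transAux L L' S hS) := fun x ↦
    (analyticAt_transAux hS hS0 hSd x).differentiableAt
  have := hd.apply_eq_apply_of_bounded (IsZLattice.isCompact_range_of_periodic L.lattice _
    hd.continuous fun z l hl ↦ by
      lift l to L.lattice using hl; exact transAux_add_coe hS hS0 hSd z l).isBounded z 0
  rw [this, transAux_of_sub_mem hS hSd hS0 (by simp)]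
  congr 1
  exact Finset.sum_congr rfl fun c _ ↦ by rw [zero_sub, L.weierstrassP_neg]

/-- **The transformation of order `n` of `℘`.**  Let `Λ ⊂ Λ'` be lattices and `S ∋ 0` a system
of representatives of `Λ'/Λ` (`x ∈ Λ' ↔ ∃ c ∈ S, x − c ∈ Λ`, representatives of distinct
classes).  Then for `z ∉ Λ'`, `℘_{Λ'}(z) = Σ_{c ∈ S} ℘_Λ(z − c) − Σ_{c ∈ S, c ≠ 0} ℘_Λ(c)`
(Lawden §9.8: the transformations of order `n` are products of first-order ones and of
`℘(u | nω₁, ω₃) = n⁻²{Σ_k ℘(u/n + 2kω₁/n) − Σ_{k≠0} ℘(2kω₁/n)}`, (9.8.4)–(9.8.5), (9.8.14); "it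
follows, using Liouville's theorem"), proved by Liouville's theorem: the difference is
`Λ`-periodic and entire (`transAux_eq`). [cite: Lawden1989, §9.8 eqs. (9.8.3)–(9.8.7), (9.8.14)] -/
theorem weierstrassP_transformation (hS : ∀ x, x ∈ L'.lattice ↔ ∃ c ∈ S, x - c ∈ L.lattice)
    (hS0 : (0 : ℂ) ∈ S) (hSd : ∀ c ∈ S, ∀ c' ∈ S, c - c' ∈ L.lattice → c = c') {z : ℂ}
    (hz : z ∉ L'.lattice) :
    ℘[L'] z = ∑ c ∈ S, ℘[L] (z - c) - ∑ c ∈ S.erase 0, ℘[L] c := by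
  have := transAux_eq hS hS0 hSd z
  rw [transAux_of_notMem hS hz] at this
  linear_combination this

end Transformation

/-! ### Lattices of index five: `Λ' = Λ ∪ (±w + Λ) ∪ (±2w + Λ)` -/

section IndexFive

/-- The representatives `{0, w, −w, 2w, −2w}` of `Λ'/Λ` for a cyclic superlattice of index five.
[folklore] -/
def repsFive (w : ℂ) : Finset ℂ := {0, w, -w, 2 * w, -(2 * w)}

/-- `0 ∈ {0, ±w, ±2w}`. [folklore] -/
lemma zero_mem_repsFive (w : ℂ) : (0 : ℂ) ∈ repsFive w := by simp [repsFive]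

/-- Translation of the five-coset hypothesis into the representative form. [folklore] -/
lemma reps_of_indexFive
    (hΛ : ∀ x, x ∈ L'.lattice ↔ x ∈ L.lattice ∨ x - w ∈ L.lattice ∨ x + w ∈ L.lattice ∨
      x - 2 * w ∈ L.lattice ∨ x + 2 * w ∈ L.lattice) (x : ℂ) :
    x ∈ L'.lattice ↔ ∃ c ∈ repsFive w, x - c ∈ L.lattice := by
  rw [hΛ]
  simp only [repsFive, Finset.mem_insert, Finset.mem_singleton, or_and_right, exists_or,
    exists_eq_left, sub_zero, sub_neg_eq_add]

/-- Small multiples: `mw ∉ Λ` for `0 < |m| ≤ 4` when `w, 2w, 3w, 4w ∉ Λ`. [folklore] -/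
lemma int_mul_w_notMem (h1 : w ∉ L.lattice) (h2 : 2 * w ∉ L.lattice) (h3 : 3 * w ∉ L.lattice)
    (h4 : 4 * w ∉ L.lattice) {m : ℤ} (hm : -4 ≤ m) (hm' : m ≤ 4) (h : (m : ℂ) * w ∈ L.lattice) :
    m = 0 := by
  have hn : ∀ x : ℂ, x ∉ L.lattice → -x ∉ L.lattice := fun x hx h ↦ hx (by simpa using neg_mem h)
  interval_cases m
  · exact absurd (by push_cast at h; simpa [neg_mul] using h) (hn _ h4)
  · exact absurd (by push_cast at h; simpa [neg_mul] using h) (hn _ h3)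
  · exact absurd (by push_cast at h; simpa [neg_mul] using h) (hn _ h2)
  · exact absurd (by push_cast at h; simpa [neg_mul] using h) (hn _ h1)
  · rfl
  · exact absurd (by push_cast at h; simpa using h) h1
  · exact absurd (by push_cast at h; simpa using h) h2
  · exact absurd (by push_cast at h; simpa using h) h3
  · exact absurd (by push_cast at h; simpa using h) h4

/-- Every representative is `kw` with `k ∈ {0, ±1, ±2}`. [folklore] -/
lemma exists_int_of_mem_repsFive {c : ℂ} (hc : c ∈ repsFive w) :
    ∃ k : ℤ, -2 ≤ k ∧ k ≤ 2 ∧ c = k * w := by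
  simp only [repsFive, Finset.mem_insert, Finset.mem_singleton] at hc
  rcases hc with rfl | rfl | rfl | rfl | rfl
  · exact ⟨0, by norm_num, by norm_num, by simp⟩
  · exact ⟨1, by norm_num, by norm_num, by simp⟩
  · exact ⟨-1, by norm_num, by norm_num, by simp⟩
  · exact ⟨2, by norm_num, by norm_num, by push_cast; ring⟩
  · exact ⟨-2, by norm_num, by norm_num, by push_cast; ring⟩

/-- The representatives `{0, ±w, ±2w}` are pairwise incongruent mod `Λ` when `w, 2w, 3w, 4w ∉ Λ`.
[folklore] -/
lemma repsFive_incongruent (h1 : w ∉ L.lattice) (h2 : 2 * w ∉ L.lattice)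
    (h3 : 3 * w ∉ L.lattice) (h4 : 4 * w ∉ L.lattice) :
    ∀ c ∈ repsFive w, ∀ c' ∈ repsFive w, c - c' ∈ L.lattice → c = c' := by
  intro c hc c' hc' h
  obtain ⟨k, hk, hk', rfl⟩ := exists_int_of_mem_repsFive hc
  obtain ⟨k', hl, hl', rfl⟩ := exists_int_of_mem_repsFive hc'
  have hm : ((k - k' : ℤ) : ℂ) * w ∈ L.lattice := by
    push_cast
    rw [sub_mul]
    exact h
  have := int_mul_w_notMem h1 h2 h3 h4 (by omega) (by omega) hm
  rw [show k = k' by omega]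

/-- The sum over the representatives, written out. [folklore] -/
lemma sum_repsFive (h1 : w ∉ L.lattice) (h2 : 2 * w ∉ L.lattice) (h3 : 3 * w ∉ L.lattice)
    (h4 : 4 * w ∉ L.lattice) (f : ℂ → ℂ) :
    ∑ c ∈ repsFive w, f c = f 0 + f w + f (-w) + f (2 * w) + f (-(2 * w)) := by
  have hw0 : w ≠ 0 := fun h ↦ h1 (h ▸ zero_mem _)
  have hne : ∀ x : ℂ, x ∉ L.lattice → x ≠ 0 := fun x hx h ↦ hx (h ▸ zero_mem _)
  have e1 : (0 : ℂ) ∉ ({w, -w, 2 * w, -(2 * w)} : Finset ℂ) := by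
    simp only [Finset.mem_insert, Finset.mem_singleton, not_or]
    refine ⟨fun h ↦ hw0 h.symm, fun h ↦ hw0 (by linear_combination h),
      fun h ↦ hne _ h2 h.symm, fun h ↦ hne _ h2 (by linear_combination h)⟩
  have e2 : w ∉ ({-w, 2 * w, -(2 * w)} : Finset ℂ) := by
    simp only [Finset.mem_insert, Finset.mem_singleton, not_or]
    refine ⟨fun h ↦ hne _ h2 (by linear_combination h), fun h ↦ hw0 (by linear_combination -h),
      fun h ↦ hne _ h3 (by linear_combination h)⟩
  have e3 : -w ∉ ({2 * w, -(2 * w)} : Finset ℂ) := by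
    simp only [Finset.mem_insert, Finset.mem_singleton, not_or]
    exact ⟨fun h ↦ hne _ h3 (by linear_combination -h), fun h ↦ hw0 (by linear_combination h)⟩
  have e4 : 2 * w ∉ ({-(2 * w)} : Finset ℂ) := by
    simp only [Finset.mem_singleton]
    exact fun h ↦ hne _ h4 (by linear_combination h)
  rw [repsFive, Finset.sum_insert e1, Finset.sum_insert e2, Finset.sum_insert e3,
    Finset.sum_insert e4, Finset.sum_singleton]
  ring

/-- The sum of `℘_Λ` over the nonzero representatives: `2℘(w) + 2℘(2w)`. [folklore] -/
lemma sum_repsFive_erase_zero (h1 : w ∉ L.lattice) (h2 : 2 * w ∉ L.lattice)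
    (h3 : 3 * w ∉ L.lattice) (h4 : 4 * w ∉ L.lattice) :
    ∑ c ∈ (repsFive w).erase 0, ℘[L] c = 2 * ℘[L] w + 2 * ℘[L] (2 * w) := by
  have h := sum_repsFive h1 h2 h3 h4 (℘[L])
  rw [← Finset.add_sum_erase _ _ (zero_mem_repsFive w), L.weierstrassP_zero, zero_add,
    L.weierstrassP_neg, L.weierstrassP_neg] at h
  linear_combination h

/-- `5w ∈ Λ` for a cyclic superlattice of index five. [folklore] -/
lemma five_mul_w_mem_of_indexFive
    (hΛ : ∀ x, x ∈ L'.lattice ↔ x ∈ L.lattice ∨ x - w ∈ L.lattice ∨ x + w ∈ L.lattice ∨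
      x - 2 * w ∈ L.lattice ∨ x + 2 * w ∈ L.lattice)
    (h1 : w ∉ L.lattice) (h2 : 2 * w ∉ L.lattice) (h3 : 3 * w ∉ L.lattice)
    (h4 : 4 * w ∉ L.lattice) : 5 * w ∈ L.lattice := by
  have hw : w ∈ L'.lattice := (hΛ w).mpr (Or.inr (Or.inl (by simp)))
  have h2w : 2 * w ∈ L'.lattice := (hΛ (2 * w)).mpr (Or.inr (Or.inr (Or.inr (Or.inl (by simp)))))
  have h3w : 3 * w ∈ L'.lattice := by
    rw [show 3 * w = w + 2 * w by ring]; exact add_mem hw h2w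
  rcases (hΛ _).mp h3w with h | h | h | h | h
  · exact absurd h h3
  · exact absurd (by convert h using 1; ring) h2
  · exact absurd (by convert h using 1; ring) h4
  · exact absurd (by convert h using 1; ring) h1
  · convert h using 1; ring

/-- **`℘` of a cyclic superlattice of index five**: if `Λ' = Λ ∪ (±w + Λ) ∪ (±2w + Λ)` with
`w, 2w, 3w, 4w ∉ Λ`, then for `z ∉ Λ'`,
`℘_{Λ'}(z) = ℘(z) + ℘(z − w) + ℘(z + w) + ℘(z − 2w) + ℘(z + 2w) − 2℘(w) − 2℘(2w)` (the case
`n = 5` of `weierstrassP_transformation`). [cite: Lawden1989, §9.8 eqs. (9.8.3)–(9.8.7), (9.8.14)] -/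
theorem weierstrassP_of_indexFive
    (hΛ : ∀ x, x ∈ L'.lattice ↔ x ∈ L.lattice ∨ x - w ∈ L.lattice ∨ x + w ∈ L.lattice ∨
      x - 2 * w ∈ L.lattice ∨ x + 2 * w ∈ L.lattice)
    (h1 : w ∉ L.lattice) (h2 : 2 * w ∉ L.lattice) (h3 : 3 * w ∉ L.lattice)
    (h4 : 4 * w ∉ L.lattice) {z : ℂ} (hz : z ∉ L'.lattice) :
    ℘[L'] z = ℘[L] z + ℘[L] (z - w) + ℘[L] (z + w) + ℘[L] (z - 2 * w) + ℘[L] (z + 2 * w) -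
      2 * ℘[L] w - 2 * ℘[L] (2 * w) := by
  have h := weierstrassP_transformation (reps_of_indexFive hΛ) (zero_mem_repsFive w)
    (repsFive_incongruent h1 h2 h3 h4) hz
  rw [sum_repsFive h1 h2 h3 h4, sum_repsFive_erase_zero h1 h2 h3 h4] at h
  rw [h]
  simp only [sub_zero, sub_neg_eq_add]
  ring

end IndexFive

/-! ### The invariants of a cyclic superlattice of index five -/

section VeluFive

/-- Off `Λ'`, `(℘_{Λ'} − ℘_Λ)(℘_Λ − e₁)²(℘_Λ − e₂)²` is the cubic
`((6e₁² − g₂/2)℘ − C₁)(℘ − e₂)² + ((6e₂² − g₂/2)℘ − C₂)(℘ − e₁)²`, `C_i = 2e_i³ + g₂e_i/2 + g₃`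
(`e₁ = ℘_Λ(w)`, `e₂ = ℘_Λ(2w)`): the index-five formula combined with
`weierstrassP_add_add_weierstrassP_sub` at `w` and `2w`. [folklore] -/
theorem weierstrassP_sub_mul_of_indexFive
    (hΛ : ∀ x, x ∈ L'.lattice ↔ x ∈ L.lattice ∨ x - w ∈ L.lattice ∨ x + w ∈ L.lattice ∨
      x - 2 * w ∈ L.lattice ∨ x + 2 * w ∈ L.lattice)
    (h1 : w ∉ L.lattice) (h2 : 2 * w ∉ L.lattice) (h3 : 3 * w ∉ L.lattice)
    (h4 : 4 * w ∉ L.lattice) {z : ℂ} (hz : z ∉ L'.lattice) :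
    (℘[L'] z - ℘[L] z) * (℘[L] z - ℘[L] w) ^ 2 * (℘[L] z - ℘[L] (2 * w)) ^ 2 =
      ((6 * ℘[L] w ^ 2 - L.g₂ / 2) * ℘[L] z
          - (2 * ℘[L] w ^ 3 + L.g₂ * ℘[L] w / 2 + L.g₃)) * (℘[L] z - ℘[L] (2 * w)) ^ 2 +
      ((6 * ℘[L] (2 * w) ^ 2 - L.g₂ / 2) * ℘[L] z
          - (2 * ℘[L] (2 * w) ^ 3 + L.g₂ * ℘[L] (2 * w) / 2 + L.g₃)) * (℘[L] z - ℘[L] w) ^ 2 := by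
  have hzΛ : z ∉ L.lattice := fun h ↦ hz ((hΛ z).mpr (Or.inl h))
  have hzw : z - w ∉ L.lattice := fun h ↦ hz ((hΛ z).mpr (Or.inr (Or.inl h)))
  have hzw' : z + w ∉ L.lattice := fun h ↦ hz ((hΛ z).mpr (Or.inr (Or.inr (Or.inl h))))
  have hz2w : z - 2 * w ∉ L.lattice := fun h ↦
    hz ((hΛ z).mpr (Or.inr (Or.inr (Or.inr (Or.inl h)))))
  have hz2w' : z + 2 * w ∉ L.lattice := fun h ↦
    hz ((hΛ z).mpr (Or.inr (Or.inr (Or.inr (Or.inr h)))))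
  have hne1 : ℘[L] z ≠ ℘[L] w := fun h ↦ by
    rcases (L.weierstrassP_eq_weierstrassP_iff hzΛ h1).mp h with h' | h'
    · exact hzw' h'
    · exact hzw h'
  have hne2 : ℘[L] z ≠ ℘[L] (2 * w) := fun h ↦ by
    rcases (L.weierstrassP_eq_weierstrassP_iff hzΛ h2).mp h with h' | h'
    · exact hz2w' h'
    · exact hz2w h'
  have hD1 : ℘[L] z - ℘[L] w ≠ 0 := sub_ne_zero.mpr hne1
  have hD2 : ℘[L] z - ℘[L] (2 * w) ≠ 0 := sub_ne_zero.mpr hne2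
  have h0 := weierstrassP_of_indexFive hΛ h1 h2 h3 h4 hz
  have hP1 := weierstrassP_add_add_weierstrassP_sub hzΛ h1 hzw hzw'
  have hP2 := weierstrassP_add_add_weierstrassP_sub hzΛ h2 hz2w hz2w'
  rw [show ℘[L'] z - ℘[L] z = (℘[L] (z + w) + ℘[L] (z - w)) + (℘[L] (z + 2 * w) +
      ℘[L] (z - 2 * w)) - 2 * ℘[L] w - 2 * ℘[L] (2 * w) by rw [h0]; ring, hP1, hP2]
  field_simp
  ring

/-- The analytic germ at `0` for index five:
`S₅(z) = (℘⁻_{Λ'} − ℘⁻_Λ)(z) · (z²℘⁻_Λ + 1 − e₁z²)² (z²℘⁻_Λ + 1 − e₂z²)²`. [folklore] -/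
def veluFiveAux (L L' : PeriodPair) (e₁ e₂ : ℂ) (z : ℂ) : ℂ :=
  (℘[L' - (0 : ℂ)] z - ℘[L - (0 : ℂ)] z) *
    ((z ^ 2 * ℘[L - (0 : ℂ)] z + 1 - e₁ * z ^ 2) * (z ^ 2 * ℘[L - (0 : ℂ)] z + 1 - e₁ * z ^ 2)) *
    ((z ^ 2 * ℘[L - (0 : ℂ)] z + 1 - e₂ * z ^ 2) * (z ^ 2 * ℘[L - (0 : ℂ)] z + 1 - e₂ * z ^ 2))

/-- The right-hand germ `R₅(z) = z²{((6e₁² − g₂/2)(z²℘⁻ + 1) − C₁z²)(z²℘⁻ + 1 − e₂z²)² +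
((6e₂² − g₂/2)(z²℘⁻ + 1) − C₂z²)(z²℘⁻ + 1 − e₁z²)²}`. [folklore] -/
def veluFiveRhs (L : PeriodPair) (e₁ e₂ : ℂ) (z : ℂ) : ℂ :=
  z ^ 2 * (((6 * e₁ ^ 2 - L.g₂ / 2) * (z ^ 2 * ℘[L - (0 : ℂ)] z + 1)
      - (2 * e₁ ^ 3 + L.g₂ * e₁ / 2 + L.g₃) * z ^ 2) *
      ((z ^ 2 * ℘[L - (0 : ℂ)] z + 1 - e₂ * z ^ 2) * (z ^ 2 * ℘[L - (0 : ℂ)] z + 1 - e₂ * z ^ 2)) +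
    ((6 * e₂ ^ 2 - L.g₂ / 2) * (z ^ 2 * ℘[L - (0 : ℂ)] z + 1)
      - (2 * e₂ ^ 3 + L.g₂ * e₂ / 2 + L.g₃) * z ^ 2) *
      ((z ^ 2 * ℘[L - (0 : ℂ)] z + 1 - e₁ * z ^ 2) * (z ^ 2 * ℘[L - (0 : ℂ)] z + 1 - e₁ * z ^ 2)))

/-- `S₅` is analytic at `0`. [folklore] -/
lemma analyticAt_veluFiveAux (L L' : PeriodPair) (e₁ e₂ : ℂ) :
    AnalyticAt ℂ (veluFiveAux L L' e₁ e₂) 0 := by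
  unfold veluFiveAux
  fun_prop

/-- `R₅` is analytic at `0`. [folklore] -/
lemma analyticAt_veluFiveRhs (L : PeriodPair) (e₁ e₂ : ℂ) :
    AnalyticAt ℂ (veluFiveRhs L e₁ e₂) 0 := by
  unfold veluFiveRhs
  fun_prop

/-- Off `0` near `0`, `S₅ = R₅` (index five, `e₁ = ℘(w)`, `e₂ = ℘(2w)`). [folklore] -/
lemma veluFiveAux_eq_of_notMem
    (hΛ : ∀ x, x ∈ L'.lattice ↔ x ∈ L.lattice ∨ x - w ∈ L.lattice ∨ x + w ∈ L.lattice ∨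
      x - 2 * w ∈ L.lattice ∨ x + 2 * w ∈ L.lattice)
    (h1 : w ∉ L.lattice) (h2 : 2 * w ∉ L.lattice) (h3 : 3 * w ∉ L.lattice)
    (h4 : 4 * w ∉ L.lattice) {z : ℂ} (hz : z ∉ L'.lattice) :
    veluFiveAux L L' (℘[L] w) (℘[L] (2 * w)) z = veluFiveRhs L (℘[L] w) (℘[L] (2 * w)) z := by
  have hz0 : z ≠ 0 := fun h ↦ hz (h ▸ zero_mem _)
  have key := weierstrassP_sub_mul_of_indexFive hΛ h1 h2 h3 h4 hz
  rw [L'.weierstrassP_eq_weierstrassPExcept_add z, L.weierstrassP_eq_weierstrassPExcept_add z]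
    at key
  have : veluFiveAux L L' (℘[L] w) (℘[L] (2 * w)) z =
      z ^ 8 * ((℘[L' - (0 : ℂ)] z + 1 / z ^ 2 - (℘[L - (0 : ℂ)] z + 1 / z ^ 2)) *
        (℘[L - (0 : ℂ)] z + 1 / z ^ 2 - ℘[L] w) ^ 2 *
        (℘[L - (0 : ℂ)] z + 1 / z ^ 2 - ℘[L] (2 * w)) ^ 2) := by
    unfold veluFiveAux
    field_simp
    ring
  rw [this, key, veluFiveRhs]
  field_simp

/-- Near `0` (including `0`), `S₅ = R₅` (isolated zeros). [folklore] -/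
lemma veluFiveAux_eventuallyEq
    (hΛ : ∀ x, x ∈ L'.lattice ↔ x ∈ L.lattice ∨ x - w ∈ L.lattice ∨ x + w ∈ L.lattice ∨
      x - 2 * w ∈ L.lattice ∨ x + 2 * w ∈ L.lattice)
    (h1 : w ∉ L.lattice) (h2 : 2 * w ∉ L.lattice) (h3 : 3 * w ∉ L.lattice)
    (h4 : 4 * w ∉ L.lattice) :
    veluFiveAux L L' (℘[L] w) (℘[L] (2 * w)) =ᶠ[𝓝 0] veluFiveRhs L (℘[L] w) (℘[L] (2 * w)) := by
  have hT : AnalyticAt ℂ (fun z ↦ veluFiveAux L L' (℘[L] w) (℘[L] (2 * w)) z -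
      veluFiveRhs L (℘[L] w) (℘[L] (2 * w)) z) 0 :=
    (analyticAt_veluFiveAux L L' _ _).sub (analyticAt_veluFiveRhs L _ _)
  have hpunct : ∀ᶠ z in 𝓝[≠] (0 : ℂ), veluFiveAux L L' (℘[L] w) (℘[L] (2 * w)) z -
      veluFiveRhs L (℘[L] w) (℘[L] (2 * w)) z = 0 := by
    filter_upwards [self_mem_nhdsWithin,
      mem_nhdsWithin_of_mem_nhds (L'.compl_lattice_sdiff_singleton_mem_nhds 0)] with z hz0 hz
    have hzΛ' : z ∉ L'.lattice := fun h ↦ hz ⟨h, hz0⟩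
    rw [veluFiveAux_eq_of_notMem hΛ h1 h2 h3 h4 hzΛ', sub_self]
  rcases hT.eventually_eq_zero_or_eventually_ne_zero with h | h
  · filter_upwards [h] with z hz
    simpa [sub_eq_zero] using hz
  · exact absurd (h.and hpunct).exists (by simp)

attribute [local fun_prop] AnalyticAt.contDiffAt in
/-- `S₅''(0) = 6(G₄(Λ') − G₄(Λ))`. [folklore] -/
lemma iteratedDeriv_two_veluFiveAux (L L' : PeriodPair) (e₁ e₂ : ℂ) :
    iteratedDeriv 2 (veluFiveAux L L' e₁ e₂) 0 = 6 * (L'.G 4 - L.G 4) := by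
  unfold veluFiveAux
  simp (discharger := fun_prop) only [iteratedDeriv_fun_add, iteratedDeriv_fun_sub,
    iteratedDeriv_fun_mul, iteratedDeriv_const, iteratedDeriv_fun_pow_zero,
    iteratedDeriv_weierstrassPExcept_self]
  simp [Finset.sum_range_succ, L.G_eq_zero_of_odd 3 (by decide), L'.G_eq_zero_of_odd 3 (by decide),
    Nat.factorial]
  ring

-- the fourth derivative of a five-fold product: the Leibniz expansion is large but mechanical
set_option maxHeartbeats 800000 in
attribute [local fun_prop] AnalyticAt.contDiffAt in
/-- `S₅⁗(0) = 120(G₆(Λ') − G₆(Λ)) − 144(e₁ + e₂)(G₄(Λ') − G₄(Λ))`. [folklore] -/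
lemma iteratedDeriv_four_veluFiveAux (L L' : PeriodPair) (e₁ e₂ : ℂ) :
    iteratedDeriv 4 (veluFiveAux L L' e₁ e₂) 0 =
      120 * (L'.G 6 - L.G 6) - 144 * (e₁ + e₂) * (L'.G 4 - L.G 4) := by
  unfold veluFiveAux
  simp (discharger := fun_prop) only [iteratedDeriv_fun_add, iteratedDeriv_fun_sub,
    iteratedDeriv_fun_mul, iteratedDeriv_const, iteratedDeriv_fun_pow_zero,
    iteratedDeriv_weierstrassPExcept_self]
  simp [Finset.sum_range_succ, L.G_eq_zero_of_odd 3 (by decide), L'.G_eq_zero_of_odd 3 (by decide),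
    L.G_eq_zero_of_odd 5 (by decide), L'.G_eq_zero_of_odd 5 (by decide), Nat.factorial,
    show Nat.choose 4 2 = 6 by rfl]
  ring

attribute [local fun_prop] AnalyticAt.contDiffAt in
/-- `R₅''(0) = 2((6e₁² − g₂/2) + (6e₂² − g₂/2))`. [folklore] -/
lemma iteratedDeriv_two_veluFiveRhs (L : PeriodPair) (e₁ e₂ : ℂ) :
    iteratedDeriv 2 (veluFiveRhs L e₁ e₂) 0 =
      2 * ((6 * e₁ ^ 2 - L.g₂ / 2) + (6 * e₂ ^ 2 - L.g₂ / 2)) := by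
  unfold veluFiveRhs
  simp (discharger := fun_prop) only [iteratedDeriv_fun_add, iteratedDeriv_fun_sub,
    iteratedDeriv_fun_mul, iteratedDeriv_const, iteratedDeriv_fun_pow_zero,
    iteratedDeriv_weierstrassPExcept_self]
  simp [Finset.sum_range_succ, Nat.factorial]

set_option maxHeartbeats 400000 in
attribute [local fun_prop] AnalyticAt.contDiffAt in
/-- `R₅⁗(0) = −24(C₁ + C₂) − 48((6e₁² − g₂/2)e₂ + (6e₂² − g₂/2)e₁)`. [folklore] -/
lemma iteratedDeriv_four_veluFiveRhs (L : PeriodPair) (e₁ e₂ : ℂ) :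
    iteratedDeriv 4 (veluFiveRhs L e₁ e₂) 0 =
      -24 * ((2 * e₁ ^ 3 + L.g₂ * e₁ / 2 + L.g₃) + (2 * e₂ ^ 3 + L.g₂ * e₂ / 2 + L.g₃)) -
        48 * ((6 * e₁ ^ 2 - L.g₂ / 2) * e₂ + (6 * e₂ ^ 2 - L.g₂ / 2) * e₁) := by
  unfold veluFiveRhs
  simp (discharger := fun_prop) only [iteratedDeriv_fun_add, iteratedDeriv_fun_sub,
    iteratedDeriv_fun_mul, iteratedDeriv_const, iteratedDeriv_fun_pow_zero,
    iteratedDeriv_weierstrassPExcept_self]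
  simp [Finset.sum_range_succ, Nat.factorial, show Nat.choose 4 2 = 6 by rfl]
  ring

/-- **Weight four invariant of the cyclic superlattice of index five**:
`G₄(Λ') = 2e₁² + 2e₂² − 19G₄(Λ)` (`e₁ = ℘(w)`, `e₂ = ℘(2w)`). [folklore] -/
theorem G_four_of_indexFive
    (hΛ : ∀ x, x ∈ L'.lattice ↔ x ∈ L.lattice ∨ x - w ∈ L.lattice ∨ x + w ∈ L.lattice ∨
      x - 2 * w ∈ L.lattice ∨ x + 2 * w ∈ L.lattice)
    (h1 : w ∉ L.lattice) (h2 : 2 * w ∉ L.lattice) (h3 : 3 * w ∉ L.lattice)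
    (h4 : 4 * w ∉ L.lattice) :
    L'.G 4 = 2 * ℘[L] w ^ 2 + 2 * ℘[L] (2 * w) ^ 2 - 19 * L.G 4 := by
  have h := (veluFiveAux_eventuallyEq hΛ h1 h2 h3 h4).iteratedDeriv_eq 2
  rw [iteratedDeriv_two_veluFiveAux, iteratedDeriv_two_veluFiveRhs] at h
  simp only [g₂] at h
  linear_combination h / 6

/-- **Weight six invariant of the cyclic superlattice of index five**:
`G₆(Λ') = 2e₁³ + 2e₂³ − 18(e₁ + e₂)G₄(Λ) − 55G₆(Λ)`. [folklore] -/
theorem G_six_of_indexFive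
    (hΛ : ∀ x, x ∈ L'.lattice ↔ x ∈ L.lattice ∨ x - w ∈ L.lattice ∨ x + w ∈ L.lattice ∨
      x - 2 * w ∈ L.lattice ∨ x + 2 * w ∈ L.lattice)
    (h1 : w ∉ L.lattice) (h2 : 2 * w ∉ L.lattice) (h3 : 3 * w ∉ L.lattice)
    (h4 : 4 * w ∉ L.lattice) :
    L'.G 6 = 2 * ℘[L] w ^ 3 + 2 * ℘[L] (2 * w) ^ 3 -
      18 * (℘[L] w + ℘[L] (2 * w)) * L.G 4 - 55 * L.G 6 := by
  have h4' := G_four_of_indexFive hΛ h1 h2 h3 h4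
  have h := (veluFiveAux_eventuallyEq hΛ h1 h2 h3 h4).iteratedDeriv_eq 4
  rw [iteratedDeriv_four_veluFiveAux, iteratedDeriv_four_veluFiveRhs] at h
  simp only [g₂, g₃] at h
  linear_combination h / 120 + 6 / 5 * (℘[L] w + ℘[L] (2 * w)) * h4'

end VeluFive

/-! ### The duplication relation and complex multiplication by an element of norm five -/

section CMFive

variable {α : ℂ}

/-- **The duplication relation**: for `u, 2u ∉ Λ`,
`4(℘(2u) + 2℘(u))(4℘(u)³ − g₂℘(u) − g₃) = (6℘(u)² − g₂/2)²` — the duplication formula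
`℘(2u) = ¼(℘''(u)/℘'(u))² − 2℘(u)` (Lawden (6.8.10) with `v → u`; tree
`PeriodPair.weierstrassP_two_mul_holds`) with `℘'' = 6℘² − g₂/2` and `℘'² = 4℘³ − g₂℘ − g₃`,
cleared of denominators. [folklore] -/
theorem duplication_relation {u : ℂ} (hu : u ∉ L.lattice) (h2u : 2 * u ∉ L.lattice) :
    4 * (℘[L] (2 * u) + 2 * ℘[L] u) * (4 * ℘[L] u ^ 3 - L.g₂ * ℘[L] u - L.g₃) =
      (6 * ℘[L] u ^ 2 - L.g₂ / 2) ^ 2 := by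
  have h' : ℘'[L] u ≠ 0 := fun h ↦ h2u (L.two_mul_mem_lattice_of_derivWeierstrassP_eq_zero hu h)
  have hdup := L.weierstrassP_two_mul_holds u hu h'
  rw [L.deriv_derivWeierstrassP hu] at hdup
  have hsq := L.derivWeierstrassP_sq u hu
  have : 4 * (℘[L] (2 * u) + 2 * ℘[L] u) * ℘'[L] u ^ 2 = (6 * ℘[L] u ^ 2 - L.g₂ / 2) ^ 2 := by
    rw [hdup]
    field_simp
    ring
  rwa [hsq] at this

/-- **Complex multiplication of degree five, first relation**: if
`α⁻¹Λ = Λ ∪ (±w + Λ) ∪ (±2w + Λ)` with `w, 2w, 3w, 4w ∉ Λ` (`αΛ ⊂ Λ` of index `5`), then with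
`e₁ = ℘(w)`, `e₂ = ℘(2w)`: `2e₁² + 2e₂² = (α⁴ + 19)G₄(Λ)`. [folklore] -/
theorem weierstrassP_sq_of_cmFive (hα : α ≠ 0)
    (hΛ : ∀ x, α * x ∈ L.lattice ↔ x ∈ L.lattice ∨ x - w ∈ L.lattice ∨ x + w ∈ L.lattice ∨
      x - 2 * w ∈ L.lattice ∨ x + 2 * w ∈ L.lattice)
    (h1 : w ∉ L.lattice) (h2 : 2 * w ∉ L.lattice) (h3 : 3 * w ∉ L.lattice)
    (h4 : 4 * w ∉ L.lattice) :
    2 * ℘[L] w ^ 2 + 2 * ℘[L] (2 * w) ^ 2 = (α ^ 4 + 19) * L.G 4 := by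
  have hΛ' : ∀ x, x ∈ (L.mulLeft α⁻¹ (inv_ne_zero hα)).lattice ↔ x ∈ L.lattice ∨
      x - w ∈ L.lattice ∨ x + w ∈ L.lattice ∨ x - 2 * w ∈ L.lattice ∨ x + 2 * w ∈ L.lattice :=
    fun x ↦ by rw [mem_mulLeft_inv_lattice hα, hΛ]
  have h := G_four_of_indexFive hΛ' h1 h2 h3 h4
  rw [G_mulLeft_inv hα] at h
  linear_combination -h

/-- **Complex multiplication of degree five, second relation**: with the same hypotheses,
`(α⁶ + 55)G₆(Λ) = 2e₁³ + 2e₂³ − 18(e₁ + e₂)G₄(Λ)`. [folklore] -/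
theorem G_six_of_cmFive (hα : α ≠ 0)
    (hΛ : ∀ x, α * x ∈ L.lattice ↔ x ∈ L.lattice ∨ x - w ∈ L.lattice ∨ x + w ∈ L.lattice ∨
      x - 2 * w ∈ L.lattice ∨ x + 2 * w ∈ L.lattice)
    (h1 : w ∉ L.lattice) (h2 : 2 * w ∉ L.lattice) (h3 : 3 * w ∉ L.lattice)
    (h4 : 4 * w ∉ L.lattice) :
    (α ^ 6 + 55) * L.G 6 =
      2 * ℘[L] w ^ 3 + 2 * ℘[L] (2 * w) ^ 3 - 18 * (℘[L] w + ℘[L] (2 * w)) * L.G 4 := by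
  have hΛ' : ∀ x, x ∈ (L.mulLeft α⁻¹ (inv_ne_zero hα)).lattice ↔ x ∈ L.lattice ∨
      x - w ∈ L.lattice ∨ x + w ∈ L.lattice ∨ x - 2 * w ∈ L.lattice ∨ x + 2 * w ∈ L.lattice :=
    fun x ↦ by rw [mem_mulLeft_inv_lattice hα, hΛ]
  have h := G_six_of_indexFive hΛ' h1 h2 h3 h4
  rw [G_mulLeft_inv hα] at h
  linear_combination h

/-- **`j = −884736 = (−96)³` for a lattice with complex multiplication by `(1 + √−19)/2`**: if
`α² = α − 5` and `α⁻¹Λ = Λ ∪ (±w + Λ) ∪ (±2w + Λ)`, `w, 2w, 3w, 4w ∉ Λ`, then `6272G₆² = 2565G₄³`,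
whence `j(Λ) = −884736` — the value `j((1 + √−19)/2) = −96³` of Cox's table (12.20), obtained
here by the method of §10.C for an element of norm `5`: the two CM relations are supplemented by
the duplication relations at `w` and `2w` (`℘(4w) = ℘(w)` as `5w ∈ Λ`), whose difference gives the
symmetric cubic `s³ − 6ps + 30G₄s + 140G₆ = 0` (`s = e₁ + e₂`, `p = e₁e₂`); elimination yields
`2s² = 15(5 − α)G₄`, `280G₆ = −3(9 + α)sG₄`.
[cite: Cox2013, §12.C table (12.20) row d_K = -19 (method of §10.C (10.21)–(10.22))] -/
theorem j_eq_of_cmFive_of_sq_eq_self_sub_five (hα2 : α ^ 2 = α - 5)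
    (hΛ : ∀ x, α * x ∈ L.lattice ↔ x ∈ L.lattice ∨ x - w ∈ L.lattice ∨ x + w ∈ L.lattice ∨
      x - 2 * w ∈ L.lattice ∨ x + 2 * w ∈ L.lattice)
    (h1 : w ∉ L.lattice) (h2 : 2 * w ∉ L.lattice) (h3 : 3 * w ∉ L.lattice)
    (h4 : 4 * w ∉ L.lattice) :
    L.j = -884736 := by
  have hα : α ≠ 0 := by rintro rfl; norm_num at hα2
  have hα4 : α ^ 4 = 20 - 9 * α := by
    linear_combination (α ^ 2 + α - 4) * hα2
  have hα6 : α ^ 6 = 56 * α - 55 := by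
    linear_combination (α ^ 4 + α ^ 3 - 4 * α ^ 2 - 9 * α + 11) * hα2
  -- the superlattice α⁻¹Λ and `5w ∈ Λ`
  have hΛ' : ∀ x, x ∈ (L.mulLeft α⁻¹ (inv_ne_zero hα)).lattice ↔ x ∈ L.lattice ∨
      x - w ∈ L.lattice ∨ x + w ∈ L.lattice ∨ x - 2 * w ∈ L.lattice ∨ x + 2 * w ∈ L.lattice :=
    fun x ↦ by rw [mem_mulLeft_inv_lattice hα, hΛ]
  have h5w : 5 * w ∈ L.lattice := five_mul_w_mem_of_indexFive hΛ' h1 h2 h3 h4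
  set e₁ := ℘[L] w with he₁
  set e₂ := ℘[L] (2 * w) with he₂
  -- `℘(4w) = e₁`
  have h4w : ℘[L] (2 * (2 * w)) = e₁ := by
    have := L.weierstrassP_sub_coe (4 * w) ⟨5 * w, h5w⟩
    rw [Subtype.coe_mk, show 4 * w - 5 * w = -w by ring, L.weierstrassP_neg] at this
    rw [show 2 * (2 * w) = 4 * w by ring, ← this, he₁]
  -- the two CM relations
  have V1 := weierstrassP_sq_of_cmFive hα hΛ h1 h2 h3 h4
  have V2 := G_six_of_cmFive hα hΛ h1 h2 h3 h4
  rw [hα4] at V1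
  rw [hα6] at V2
  -- the two duplication relations
  have D1 := duplication_relation h1 h2
  have D2 := duplication_relation h2 (by rw [show 2 * (2 * w) = 4 * w by ring]; exact h4)
  rw [h4w] at D2
  simp only [g₂, g₃, ← he₁, ← he₂] at D1 D2
  -- `e₁ ≠ e₂`
  have hne : e₁ ≠ e₂ := fun h ↦ by
    rcases (L.weierstrassP_eq_weierstrassP_iff h1 h2).mp h with h' | h'
    · exact h3 (by convert h' using 1; ring)
    · exact h1 (by convert neg_mem h' using 1; ring)
  -- the symmetric cubic: (D1 − D2)/(e₁ − e₂)
  have Δ : (e₁ + e₂) ^ 3 - 6 * (e₁ * e₂) * (e₁ + e₂) + 30 * L.G 4 * (e₁ + e₂) +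
      140 * L.G 6 = 0 := by
    have : (e₁ - e₂) * ((e₁ + e₂) ^ 3 - 6 * (e₁ * e₂) * (e₁ + e₂) + 30 * L.G 4 * (e₁ + e₂) +
        140 * L.G 6) = 0 := by
      linear_combination (-1 / 4) * D1 + (1 / 4) * D2
    exact (mul_eq_zero.mp this).resolve_left (sub_ne_zero.mpr hne)
  -- elimination
  have E : (5 + α) * (e₁ + e₂) ^ 3 - (15 + 6 * α) * (e₁ * e₂) * (e₁ + e₂) +
      (30 * α - 45) * L.G 4 * (e₁ + e₂) = 0 := by
    linear_combination (-5 / 2) * V2 + α * Δ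
  have F : (4 * (5 + α) - 2 * (15 + 6 * α)) * (e₁ + e₂) ^ 3 +
      ((15 + 6 * α) * (39 - 9 * α) + 4 * (30 * α - 45)) * L.G 4 * (e₁ + e₂) = 0 := by
    linear_combination 4 * E - (15 + 6 * α) * (e₁ + e₂) * V1
  -- `s = e₁ + e₂ ≠ 0`
  have hs : e₁ + e₂ ≠ 0 := by
    intro hs
    have hG6 : L.G 6 = 0 := by
      linear_combination Δ / 140 - ((e₁ + e₂) ^ 2 - 6 * (e₁ * e₂) + 30 * L.G 4) / 140 * hs
    have h4e : 4 * e₁ ^ 2 = (39 - 9 * α) * L.G 4 := by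
      linear_combination V1 + 2 * (e₁ - e₂) * hs
    have he2 : e₂ = -e₁ := by linear_combination hs
    rw [he2, hG6] at D1
    have hq1 : 20 * e₁ ^ 4 - 120 * L.G 4 * e₁ ^ 2 + 900 * L.G 4 ^ 2 = 0 := by
      linear_combination -D1
    have hq2 : ((39 - 9 * α) ^ 2 - 24 * (39 - 9 * α) + 720) * L.G 4 ^ 2 = 0 := by
      linear_combination (4 / 5) * hq1 - (4 * e₁ ^ 2 + (39 - 9 * α) * L.G 4 - 24 * L.G 4) * h4e
    have hq3 : (45 * (20 - 9 * α)) * L.G 4 ^ 2 = 0 := by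
      linear_combination hq2 - 81 * L.G 4 ^ 2 * hα2
    have h209 : (45 : ℂ) * (20 - 9 * α) ≠ 0 := by
      refine mul_ne_zero (by norm_num) fun h ↦ ?_
      have hα' : α = 20 / 9 := by linear_combination -h / 9
      rw [hα'] at hα2
      norm_num at hα2
    have hG4 : L.G 4 = 0 := pow_eq_zero_iff (n := 2) (by norm_num) |>.mp
      ((mul_eq_zero.mp hq3).resolve_left h209)
    exact L.discr_ne_zero (by simp [g₂, g₃, hG4, hG6])
  have Fs : (4 * (5 + α) - 2 * (15 + 6 * α)) * (e₁ + e₂) ^ 2 +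
      ((15 + 6 * α) * (39 - 9 * α) + 4 * (30 * α - 45)) * L.G 4 = 0 := by
    have : (e₁ + e₂) * ((4 * (5 + α) - 2 * (15 + 6 * α)) * (e₁ + e₂) ^ 2 +
        ((15 + 6 * α) * (39 - 9 * α) + 4 * (30 * α - 45)) * L.G 4) = 0 := by
      linear_combination F
    exact (mul_eq_zero.mp this).resolve_left hs
  have U0 : (5 + 4 * α) * (2 * (e₁ + e₂) ^ 2 - (75 - 15 * α) * L.G 4) = 0 := by
    linear_combination -Fs + 6 * L.G 4 * hα2
  have h54 : (5 : ℂ) + 4 * α ≠ 0 := by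
    intro h
    have hα' : α = -5 / 4 := by linear_combination h / 4
    rw [hα'] at hα2
    norm_num at hα2
  have U : 2 * (e₁ + e₂) ^ 2 - (75 - 15 * α) * L.G 4 = 0 := (mul_eq_zero.mp U0).resolve_left h54
  have Gr : 280 * L.G 6 = -3 * (9 + α) * (e₁ + e₂) * L.G 4 := by
    linear_combination 2 * Δ + 2 * (e₁ + e₂) * U - 3 * (e₁ + e₂) * V1
  have key : 156800 * L.G 6 ^ 2 - 64125 * L.G 4 ^ 3 = 0 := by
    have sq : (280 * L.G 6) ^ 2 = (-3 * (9 + α) * (e₁ + e₂) * L.G 4) ^ 2 := by rw [Gr]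
    linear_combination 2 * sq + 9 * (9 + α) ^ 2 * L.G 4 ^ 2 * U +
      (-135 * α - 1890) * L.G 4 ^ 3 * hα2
  rw [j_def, div_eq_iff L.discr_ne_zero]
  simp only [g₂, g₃]
  linear_combination (-2985984) * key

end CMFive

end PeriodPair

end
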